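import Literature.Probability.Percolation.ArmSeparationIntFrame
import Literature.Probability.Percolation.ArmSeparationFenceBound
import Literature.Probability.Percolation.TriLowestCrossingProb
import HarnessLib

/-!
# The union bound of the separation step at INTERNAL extremities: fences fail with probability `T (1 - c_F²)^K`

Topic: Probability / Percolation; family `crit-perc` (critical site percolation on `𝕋`,
`P = P_{1/2} = triSitePercolation half`). A brick of the discharge of
`Literature.Probability.Percolation.Nolin2008_twoArm_separation` (Nolin 2008, Thm. 11
[arXiv 0711.4948: Thm. 10], `j = 2`; `ArmSeparation.lean`): the probabilistic layer over
`ArmSeparationIntFrame.lean` (deterministic core at an internal extremity: an open frame about the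
tip of an open crossing of the inner half-annulus `HalfAnnulus.intDom m`, present in a
configuration agreeing with `ω` off `lower c z`, yields in `ω` a fence and protection from above),
the internal twin of `ArmSeparationFenceBound.lean` (external extremities, trapezoid), whose
per-scale RSW events `trapRSW z k`, scales `trapScale k₀ j = k₀ · 32^j` and independence estimate
`real_iInter_compl_trapRSW_le` are reused verbatim (the frames are the same; only the exploration
domain differs). Nolin 2008, §4.4, "2. Internal extremities: the reasoning is the same".

* `RSWOff L z k₀ K` — **"some configuration agreeing with `ω` off `L` has the RSW event at some
  scale `k_j`, `j < K`"**, for an arbitrary finite set `L` of revealed sites (here `L = lower c z`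
  of any `JDomain`): determined by the annuli minus `L` (`determinedBy_rswOff`), with
  `P((RSWOff L z k₀ K)ᶜ) ≤ (1 - c_F²)^K` (`real_compl_rswOff_le`, from `real_iInter_compl_trapRSW_le`);
* `IntFenceOK m c z k ω` — the per-scale success in `ω` at an internal extremity (fence of
  `int_exists_fence` at scale `k`, protection of `int_no_closed_escape` at scale `8k`), implied by
  `ω' ∈ trapRSW z k` for any `ω'` agreeing with `ω` off `lower c z` when the tip is not within
  `2k + 1` of an end of the side (`intFenceOK_of_mem_trapRSW`);
* `IntSeqFail m T k₀ K r ω` — **failure before time `T`**: some term `u < T` of the exploration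
  sequence of `intDom m` has a tip at distance `≥ r` from both ends of the side (`IntMidTip m r`,
  with `2 k_j + 1 ≤ r` for `j < K`) whose fence fails on all `K` scales;
* `real_intSeqFail_le` — **the union bound**: `P(IntSeqFail m T k₀ K r) ≤ T (1 - c_F²)^K`, by the
  abstract union bound with conditional independence `JDomain.real_exists_lowestSeq_not_mem_le`
  (`TriLowestCrossingProb.lean`) applied to the protecting events `RSWOff (lower c z) z k₀ K`
  (Nolin 2008, (4.18)–(4.19), internal case). Tips near the ends of the side are excluded here and
  handled by corner events in the assembly.

## References

* P. Nolin, *Near-critical percolation in two dimensions*, Electron. J. Probab. 13 (2008), §4.4,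
  proof of Lemma 15, internal extremities [arXiv 0711.4948: Lemma 14, (4.18)–(4.20)]. [Nolin2008]
* H. Kesten, *Scaling relations for 2D-percolation*, Comm. Math. Phys. 109 (1987), Lemma 2. [Kesten1987]

Tree: `int_exists_fence`, `int_no_closed_escape`, `intFrameZone` (`ArmSeparationIntFrame.lean`);
`trapRSW`, `determinedBy_trapRSW`, `trapScale`, `one_le_trapScale`, `trapScalesFinset`,
`real_iInter_compl_trapRSW_le`, `sq_le_real_trapRSW` (`ArmSeparationFenceBound.lean`);
`HalfAnnulus.intDom`, `intDom_cutProp`, `intDom_dualProp`, `haSet` (`TriHalfAnnulus.lean`);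
`JDomain.lowestSeq`, `isCrossing_of_lowestSeq`, `lower_subset_D` (`TriLowestCrossing.lean`);
`JDomain.real_exists_lowestSeq_not_mem_le` (`TriLowestCrossingProb.lean`); `OpenVCrossThrough`
(`ArmSeparation.lean`).
-/

noncomputable section

open MeasureTheory Set

namespace Literature.Probability.Percolation

open LatticeModels HalfAnnulus

/-! ### RSW at some scale, in some configuration agreeing off a revealed set -/

/-- **Some configuration agreeing with `ω` off the revealed set `L` has the per-scale RSW event
`trapRSW z k_j` at some scale `j < K`** — the protecting event of a lowest crossing with revealed
set `L = lower c z` (Nolin 2008, §4.4: the annuli events "centered on `z`" restricted to the part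
of the domain above the crossing). [cite: Nolin2008, §4.4 Lemma 15 (proof) (arXiv 0711.4948: Lemma 14, (4.18))] -/
def RSWOff (L : Finset (Site 2)) (z : Site 2) (k₀ K : ℕ) : Set (SiteConfig (Site 2)) :=
  {ω | ∃ j < K, ∃ ω' : SiteConfig (Site 2), (∀ v, v ∉ L → (v ∈ ω' ↔ v ∈ ω)) ∧ ω' ∈ trapRSW z (trapScale k₀ j)}

/-- Off `RSWOff`, the configuration itself misses every `trapRSW z k_j` (take `ω' = ω`). [folklore] -/
theorem compl_rswOff_subset (L : Finset (Site 2)) (z : Site 2) (k₀ K : ℕ) :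
    (RSWOff L z k₀ K)ᶜ ⊆ ⋂ j ∈ Finset.range K, (trapRSW z (trapScale k₀ j))ᶜ := by
  intro ω hω
  simp only [Set.mem_iInter, Set.mem_compl_iff]
  intro j hj hωj
  exact hω ⟨j, Finset.mem_range.1 hj, ω, fun v _ => Iff.rfl, hωj⟩

/-- `RSWOff L z k₀ K` is determined by the sites of the annuli of the scales that are off `L`
(transplant the good configuration on the relevant annulus). [folklore] -/
theorem determinedBy_rswOff (L : Finset (Site 2)) (z : Site 2) (k₀ K : ℕ) :
    DeterminedBy (RSWOff L z k₀ K) ↑(trapScalesFinset z k₀ K \ L) := by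
  classical
  rw [determinedBy_iff]
  suffices h : ∀ ω₁ ω₂ : Set (Site 2),
      ω₁ ∩ ↑(trapScalesFinset z k₀ K \ L) = ω₂ ∩ ↑(trapScalesFinset z k₀ K \ L) →
      ω₁ ∈ RSWOff L z k₀ K → ω₂ ∈ RSWOff L z k₀ K from
    fun ω₁ ω₂ hω => ⟨h ω₁ ω₂ hω, h ω₂ ω₁ hω.symm⟩
  rintro ω₁ ω₂ hω ⟨j, hj, ω', hagree, hω'⟩
  set A := triSqAnnulusFinset z (trapScale k₀ j) (16 * trapScale k₀ j) with hA
  refine ⟨j, hj, {v | if v ∈ A then v ∈ ω' else v ∈ ω₂}, fun v hv => ?_, ?_⟩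
  · simp only [Set.mem_setOf_eq]
    split_ifs with hvA
    · rw [hagree v hv]
      have hvF : v ∈ (↑(trapScalesFinset z k₀ K \ L) : Set (Site 2)) := by
        rw [Finset.coe_sdiff]
        refine ⟨Finset.mem_coe.2 ?_, hv⟩
        rw [trapScalesFinset, Finset.mem_biUnion]
        exact ⟨j, Finset.mem_range.2 hj, hvA⟩
      have key := Set.ext_iff.1 hω v
      simp only [Set.mem_inter_iff] at key
      exact ⟨fun h1 => (key.1 ⟨h1, hvF⟩).1, fun h2 => (key.2 ⟨h2, hvF⟩).1⟩
    · exact Iff.rfl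
  · have hA' : {v | if v ∈ A then v ∈ ω' else v ∈ ω₂} ∩ (↑A : Set (Site 2)) = ω' ∩ ↑A := by
      ext v
      simp only [Set.mem_inter_iff, Set.mem_setOf_eq, Finset.mem_coe]
      constructor
      · rintro ⟨h1, h2⟩; rw [if_pos h2] at h1; exact ⟨h1, h2⟩
      · rintro ⟨h1, h2⟩; rw [if_pos h2]; exact ⟨h1, h2⟩
    exact ((determinedBy_iff _ _).1 (determinedBy_trapRSW z (trapScale k₀ j)) _ ω' hA').2 hω'

/-- `RSWOff` is measurable. [folklore] -/
theorem measurableSet_rswOff (L : Finset (Site 2)) (z : Site 2) (k₀ K : ℕ) : MeasurableSet (RSWOff L z k₀ K) :=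
  (determinedBy_rswOff L z k₀ K).measurableSet_of_finset

/-- **`P((RSWOff L z k₀ K)ᶜ) ≤ (1 - c_F²)^K`** (`real_iInter_compl_trapRSW_le`). [cite: Nolin2008, §4.4 Lemma 15 (proof) (arXiv 0711.4948: Lemma 14, (4.18))] -/
theorem real_compl_rswOff_le {cF : ℝ} (hcF : 0 < cF)
    (hF : ∀ (z : Site 2) (k : ℕ), 1 ≤ k → cF ≤ (triSitePercolation half).real (triFrameAt z k))
    (L : Finset (Site 2)) (z : Site 2) {k₀ : ℕ} (hk₀ : 1 ≤ k₀) (K : ℕ) :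
    (triSitePercolation half).real (RSWOff L z k₀ K)ᶜ ≤ (1 - cF ^ 2) ^ K :=
  (measureReal_mono (compl_rswOff_subset L z k₀ K)).trans (real_iInter_compl_trapRSW_le hcF hF z hk₀ K).1

/-- `0 ≤ 1 - c_F²` under the frame hypothesis. [folklore] -/
theorem one_sub_sq_nonneg_of_frame {cF : ℝ} (hcF : 0 < cF)
    (hF : ∀ (z : Site 2) (k : ℕ), 1 ≤ k → cF ≤ (triSitePercolation half).real (triFrameAt z k)) : 0 ≤ 1 - cF ^ 2 := by
  have := sq_le_real_trapRSW hcF hF 0 (k := 1) le_rfl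
  have h1 : (triSitePercolation half).real (trapRSW 0 1) ≤ 1 := measureReal_le_one
  linarith

/-! ### The per-scale success event at an internal extremity -/

/-- **The fence of `c` at scale `k` succeeds in `ω` (internal extremity)**: the conclusions of
`int_exists_fence` at scale `k` (an open vertical crossing of the box `[m-2k, m-k] × [t+k, t+2k]`,
inside `Λ̊_m`, through a site joined to `c` by an open path of `intFrameZone m z k`) and of
`int_no_closed_escape` at scale `8k` (no closed path of the half-annulus from a top-type site of the
inner box of half-width `8k` about `z` to outside the box of half-width `16k`). [cite: Nolin2008, §4.2 Def. 7 (free spaces, internal boundary) (arXiv 0711.4948)] -/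
def IntFenceOK (m : ℕ) (c : Finset (Site 2)) (z : Site 2) (k : ℕ) (ω : SiteConfig (Site 2)) : Prop :=
  (∃ mm : Site 2, OpenVCrossThrough (triStrip (z 0 - 2 * k) (z 1 + k) k k) (z 1 + k) (z 1 + 2 * k) ω mm ∧
      ∃ s ∈ c, PathIn triGraph (intFrameZone m z k ∩ ω) s mm) ∧
    ∀ q t : Site 2, q ∈ (intDom m).Tp ∪ (intDom m).Jabove z →
      (z 0 - 8 * k ≤ q 0 ∧ q 0 ≤ z 0 + 8 * k ∧ z 1 - 8 * k ≤ q 1 ∧ q 1 ≤ z 1 + 8 * k) →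
      (t 0 ≤ z 0 - 16 * k ∨ z 0 + 16 * k ≤ t 0 ∨ t 1 ≤ z 1 - 16 * k ∨ z 1 + 16 * k ≤ t 1) →
      ¬ PathIn triGraph (haSet m ∩ ωᶜ) q t

/-- **Tips away from the ends of the side**: `-m + r ≤ z₁ ≤ -r`. [folklore] -/
def IntMidTip (m r : ℕ) (z : Site 2) : Prop := -(m : ℤ) + r ≤ z 1 ∧ z 1 ≤ -(r : ℤ)

/-- **One good configuration off `lower c z` suffices (internal extremity)**: if `c` is a crossing
of `intDom m` (`m ≥ 5`) with tip `z`, `-m + 2k + 1 ≤ z₁ ≤ -(2k+1)`, open in `ω`, and some `ω'`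
agreeing with `ω` off `lower c z` lies in `trapRSW z k` (`1 ≤ k`), then the fence of `c` at scale
`k` succeeds in `ω`. [cite: Nolin2008, §4.4 Lemma 15 (proof) (arXiv 0711.4948: Lemma 14)] -/
theorem intFenceOK_of_mem_trapRSW {m k : ℕ} {c : Finset (Site 2)} {z : Site 2} (hm : 5 ≤ m) (hk : 1 ≤ k)
    (htk : IntMidTip m (2 * k + 1) z) (hc : (intDom m).IsCrossing c z) {ω ω' : SiteConfig (Site 2)}
    (hcω : (↑c : Set (Site 2)) ⊆ ω) (hagree : ∀ v, v ∉ (intDom m).lower c z → (v ∈ ω' ↔ v ∈ ω))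
    (hω' : ω' ∈ trapRSW z k) : IntFenceOK m c z k ω := by
  have htk' : -(m : ℤ) + 2 * k + 1 ≤ z 1 ∧ z 1 ≤ -(2 * (k : ℤ) + 1) := by
    obtain ⟨h1, h2⟩ := htk; push_cast at h1 h2; exact ⟨by linarith, by linarith⟩
  refine ⟨int_exists_fence hm hk hc htk' hcω hagree hω'.1, fun q t hq hqin ht hpath => ?_⟩
  refine int_no_closed_escape (k := 8 * k) (by omega) hc hcω hagree hω'.2 hq ?_ ?_ hpath
  · push_cast; omega
  · push_cast; omega

/-! ### Failure before time `T` and the union bound -/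

/-- **Failure of the separation step at internal extremities before time `T`**: some term `u < T`
of the exploration sequence of `intDom m` in `ω` has a tip at distance `≥ r` from both ends of the
side whose fence fails on all the scales `k_j = k₀ · 32^j`, `j < K`. [cite: Nolin2008, §4.4 Lemma 15 (proof) (arXiv 0711.4948: Lemma 14, (4.19))] -/
def IntSeqFail (m T k₀ K r : ℕ) (ω : SiteConfig (Site 2)) : Prop :=
  ∃ u < T, ∃ c z, (intDom m).lowestSeq ω u = some (c, z) ∧ IntMidTip m r z ∧
    ∀ j < K, ¬ IntFenceOK m c z (trapScale k₀ j) ω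

/-- The protecting event of a value `(c, z)`: vacuous for tips near the ends, `RSWOff` otherwise. [cite: Nolin2008, §4.4 Lemma 15 (proof) (arXiv 0711.4948: Lemma 14, (4.18))] -/
def intProt (m k₀ K r : ℕ) (c : Finset (Site 2)) (z : Site 2) : Set (SiteConfig (Site 2)) :=
  {ω | IntMidTip m r z → ω ∈ RSWOff ((intDom m).lower c z) z k₀ K}

/-- `intProt` is determined by the annuli off `lower c z`. [folklore] -/
theorem determinedBy_intProt (m k₀ K r : ℕ) (c : Finset (Site 2)) (z : Site 2) :
    DeterminedBy (intProt m k₀ K r c z) ↑(trapScalesFinset z k₀ K \ (intDom m).lower c z) := by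
  by_cases h : IntMidTip m r z
  · have : intProt m k₀ K r c z = RSWOff ((intDom m).lower c z) z k₀ K := by
      ext ω; simp only [intProt, Set.mem_setOf_eq]; exact ⟨fun h' => h' h, fun h' _ => h'⟩
    rw [this]
    exact determinedBy_rswOff _ z k₀ K
  · have : intProt m k₀ K r c z = Set.univ := by
      ext ω; simp only [intProt, Set.mem_setOf_eq, Set.mem_univ, iff_true]; exact fun h' => absurd h' h
    rw [this]
    exact determinedBy_univ _

/-- `P((intProt)ᶜ) ≤ (1 - c_F²)^K`. [cite: Nolin2008, §4.4 Lemma 15 (proof) (arXiv 0711.4948: Lemma 14, (4.18))] -/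
theorem real_compl_intProt_le {cF : ℝ} (hcF : 0 < cF)
    (hF : ∀ (z : Site 2) (k : ℕ), 1 ≤ k → cF ≤ (triSitePercolation half).real (triFrameAt z k))
    (m : ℕ) {k₀ : ℕ} (hk₀ : 1 ≤ k₀) (K r : ℕ) (c : Finset (Site 2)) (z : Site 2) :
    (triSitePercolation half).real (intProt m k₀ K r c z)ᶜ ≤ (1 - cF ^ 2) ^ K := by
  by_cases h : IntMidTip m r z
  · have : intProt m k₀ K r c z = RSWOff ((intDom m).lower c z) z k₀ K := by
      ext ω; simp only [intProt, Set.mem_setOf_eq]; exact ⟨fun h' => h' h, fun h' _ => h'⟩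
    rw [this]
    exact real_compl_rswOff_le hcF hF _ z hk₀ K
  · have : intProt m k₀ K r c z = Set.univ := by
      ext ω; simp only [intProt, Set.mem_setOf_eq, Set.mem_univ, iff_true]; exact fun h' => absurd h' h
    rw [this, Set.compl_univ, measureReal_empty]
    exact pow_nonneg (one_sub_sq_nonneg_of_frame hcF hF) K

/-- On a term `(c, z)` of the exploration sequence with a middle tip, failure on all scales puts
`ω` off `intProt` (`2 k_j + 1 ≤ r` for `j < K`, `m ≥ 5`). [cite: Nolin2008, §4.4 Lemma 15 (proof) (arXiv 0711.4948: Lemma 14)] -/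
theorem not_mem_intProt_of_fail {m u k₀ K r : ℕ} (hm : 5 ≤ m) (hk₀ : 1 ≤ k₀) (hKr : ∀ j < K, 2 * trapScale k₀ j + 1 ≤ r)
    {ω : SiteConfig (Site 2)} {c : Finset (Site 2)} {z : Site 2} (h : (intDom m).lowestSeq ω u = some (c, z))
    (hmid : IntMidTip m r z) (hfail : ∀ j < K, ¬ IntFenceOK m c z (trapScale k₀ j) ω) :
    ω ∉ intProt m k₀ K r c z := by
  intro hprot
  obtain ⟨j, hj, ω', hagree, hω'⟩ := hprot hmid
  obtain ⟨hc, hcω⟩ := JDomain.isCrossing_of_lowestSeq h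
  have htk : IntMidTip m (2 * trapScale k₀ j + 1) z := by
    obtain ⟨h1, h2⟩ := hmid
    have := hKr j hj
    have h3 : ((2 * trapScale k₀ j + 1 : ℕ) : ℤ) ≤ r := by exact_mod_cast this
    exact ⟨by linarith, by linarith⟩
  exact hfail j hj (intFenceOK_of_mem_trapRSW hm (one_le_trapScale hk₀ j) htk hc hcω hagree hω')

/-- **The union bound at internal extremities** (Nolin 2008, (4.18)–(4.19), internal case):
`P(IntSeqFail m T k₀ K r) ≤ T (1 - c_F²)^K` for `m ≥ 5`, `k₀ ≥ 1` and `2 k_j + 1 ≤ r` (`j < K`) —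
the abstract union bound with conditional independence `JDomain.real_exists_lowestSeq_not_mem_le`
for the protecting events `intProt` (determined by the annuli off `lower c z`, which is where
`{lowestSeq u = (c, z)}` is determined, `JDomain.determinedBy_lowestSeq_eq`). [cite: Nolin2008, §4.4 Lemma 15 (proof) (arXiv 0711.4948: Lemma 14, (4.19))] -/
theorem real_intSeqFail_le {cF : ℝ} (hcF : 0 < cF)
    (hF : ∀ (z : Site 2) (k : ℕ), 1 ≤ k → cF ≤ (triSitePercolation half).real (triFrameAt z k))
    {m T k₀ K r : ℕ} (hm : 5 ≤ m) (hk₀ : 1 ≤ k₀) (hKr : ∀ j < K, 2 * trapScale k₀ j + 1 ≤ r) :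
    (triSitePercolation half).real {ω | IntSeqFail m T k₀ K r ω} ≤ T * (1 - cF ^ 2) ^ K := by
  have hcut := intDom_cutProp hm
  have hdual := intDom_dualProp hm
  have h0 : 0 ≤ (1 - cF ^ 2) ^ K := pow_nonneg (one_sub_sq_nonneg_of_frame hcF hF) K
  have key := JDomain.real_exists_lowestSeq_not_mem_le hcut hdual half (Prot := intProt m k₀ K r)
    (G := fun c z => trapScalesFinset z k₀ K \ (intDom m).lower c z) h0
    (fun c z _ => determinedBy_intProt m k₀ K r c z) (fun c z _ => Finset.disjoint_sdiff)
    (fun c z _ => by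
      have := real_compl_intProt_le hcF hF m hk₀ K r c z
      unfold triSitePercolation at this
      exact this) T
  unfold triSitePercolation
  refine le_trans (measureReal_mono ?_) key
  rintro ω ⟨u, hu, c, z, h, hmid, hfail⟩
  exact ⟨u, hu, c, z, h, not_mem_intProt_of_fail hm hk₀ hKr h hmid hfail⟩

end Literature.Probability.Percolation
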